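import Mathlib
import Summits.ValiantsHypothesis.ValiantsHypothesis.Theorems.BarrierLeverPartitionMinorsHitByVPSimplexJoinAbsorb

/-!
# Route BarrierLever — item `PartitionMinorsHitByVP` (stmt-ValiantsHypothesis-19717):
# ROW-THRESHOLD ABSORPTION for the (wide) hidden-cube JOIN door — the `u`-side block-additive matrices

Helper file (`--supports stmt-ValiantsHypothesis-19717`; cell valiant-natproofs, rung V4, 𝒟-side door (c), line `hidden_states`;
prover seat val-np-p3 gen 11). Definition-free. Closes NO item.

The registered stubs of the line (`Stmt.stub_universalJoinWide`, `…pairJoinWideLower`, …) ask for tables `tx : Fin m → Option (Fin K) → Fin h → ℂ`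
making the block-additive matrix `[∏_{a ∈ u i} (tx p none a + Σ_{q ∈ J} tx p (some q) a)]_{i, (p,J) = e k}` nonsingular. This file transfers
the seat's row-threshold principle (`SimplexJoin.exists_rowScale_det_ne_zero`, p611971) to that matrix shape:

* `prod_scaled_cubePoint` — scaling piece `p₀`'s table by `c^{w a}` in coordinate `a` multiplies its columns by the row factor
  `c^{Σ_{a ∈ u i} w a}`;
* **`good_of_absorb_join`** — if the `w`-lightest rows `R` (strict threshold; `|R|` = number of columns of `p₀`) admit a table of `p₀` with
  `det ≠ 0` on `R × (columns of p₀)`, and the other rows admit tables of the other pieces with `det ≠ 0` on `Rᶜ × (other columns)`, then ONE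
  table makes the whole block-additive matrix nonsingular. With `p₀` a star this is the free-point absorption of `…HiddenStatesAddRowFree`;
  in general it is an ABSORB node for the cut-tree certificates (`Fit` / `AFit`) of the line: a piece swallows any threshold slice it is good on.

WHAT THIS IS NOT: single-piece goodness is an input; no stub is closed; nothing on crux 14610 or VP ≠ VNP.
-/

set_option linter.dupNamespace false

namespace Summit.ValiantsHypothesis.ValiantsHypothesis.Theorems.BarrierLever.SimplexJoin

open Finset Matrix

noncomputable section

variable {h : ℕ}

/-- Scaling a hidden-cube table by `c^{w a}` in coordinate `a` scales the column's row-`U` entry by `c^{Σ_{a∈U} w a}`. -/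
theorem prod_scaled_cubePoint {K : ℕ} (t : Option (Fin K) → Fin h → ℂ) (J : Finset (Fin K)) (w : Fin h → ℕ) (c : ℂ)
    (U : Finset (Fin h)) :
    ∏ a ∈ U, (c ^ w a * t none a + ∑ q ∈ J, c ^ w a * t (some q) a) =
      c ^ (∑ a ∈ U, w a) * ∏ a ∈ U, (t none a + ∑ q ∈ J, t (some q) a) := by
  rw [← Finset.prod_pow_eq_pow_sum, ← Finset.prod_mul_distrib]
  refine Finset.prod_congr rfl fun a _ => ?_
  rw [mul_add, Finset.mul_sum]

/-- **ABSORPTION for the hidden-cube join door (`u`-side).** Design `e : Fin r → Fin m × Finset (Fin K)` (no legality needed here),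
piece `p₀`, weights `w : Fin h → ℕ`; `ec` splits the columns into those of `p₀` (left) and the rest, `er` splits the rows into a
`w`-threshold slice (left, strictly lighter) and the rest. If some table is good on (slice × `p₀`-columns) and some table is good on
(rest × other columns), then some table makes the whole block-additive matrix nonsingular. -/
theorem good_of_absorb_join (h m K r : ℕ) {n n' : ℕ} (u : Fin r → Finset (Fin h))
    (e : Fin r → Fin m × Finset (Fin K)) (p₀ : Fin m) (w : Fin h → ℕ)
    (er ec : Fin n ⊕ Fin n' ≃ Fin r)
    (hPl : ∀ x, (e (ec (Sum.inl x))).1 = p₀) (hPr : ∀ y, (e (ec (Sum.inr y))).1 ≠ p₀)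
    (hthr : ∀ x y, ∑ a ∈ u (er (Sum.inl x)), w a < ∑ a ∈ u (er (Sum.inr y)), w a)
    (tx tx' : Fin m → Option (Fin K) → Fin h → ℂ)
    (hA : (Matrix.of fun x x' : Fin n => ∏ a ∈ u (er (Sum.inl x)),
      (tx (e (ec (Sum.inl x'))).1 none a + ∑ q ∈ (e (ec (Sum.inl x'))).2, tx (e (ec (Sum.inl x'))).1 (some q) a)).det ≠ 0)
    (hB : (Matrix.of fun y y' : Fin n' => ∏ a ∈ u (er (Sum.inr y)),
      (tx' (e (ec (Sum.inr y'))).1 none a + ∑ q ∈ (e (ec (Sum.inr y'))).2, tx' (e (ec (Sum.inr y'))).1 (some q) a)).det ≠ 0) :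
    ∃ T : Fin m → Option (Fin K) → Fin h → ℂ,
      (Matrix.of fun i k : Fin r => ∏ a ∈ u i,
        (T (e k).1 none a + ∑ q ∈ (e k).2, T (e k).1 (some q) a)).det ≠ 0 := by
  classical
  set T0 : Fin m → Option (Fin K) → Fin h → ℂ := fun p o a => if p = p₀ then tx p o a else tx' p o a with hT0
  set Tc : ℂ → Fin m → Option (Fin K) → Fin h → ℂ :=
    fun c p o a => if p = p₀ then c ^ w a * tx p o a else tx' p o a with hTc
  set N0 : Matrix (Fin r) (Fin r) ℂ := Matrix.of fun i k : Fin r => ∏ a ∈ u i,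
    (T0 (e k).1 none a + ∑ q ∈ (e k).2, T0 (e k).1 (some q) a) with hN0
  set P : Finset (Fin r) := Finset.univ.filter fun k => (e k).1 = p₀ with hPdef
  set R : Finset (Fin r) := Finset.univ.image fun x : Fin n => er (Sum.inl x) with hRdef
  set wt : Fin r → ℕ := fun i => ∑ a ∈ u i, w a with hwt
  have hR : ∀ i, i ∈ R ↔ ∃ x, er (Sum.inl x) = i := by
    intro i; simp [hRdef]
  have hP : ∀ k, k ∈ P ↔ ∃ x, ec (Sum.inl x) = k := by
    intro k
    rw [hPdef, Finset.mem_filter]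
    simp only [Finset.mem_univ, true_and]
    constructor
    · intro hk
      rcases hsk : ec.symm k with x | y
      · exact ⟨x, by rw [← hsk, Equiv.apply_symm_apply]⟩
      · exfalso
        apply hPr y
        have : ec (Sum.inr y) = k := by rw [← hsk, Equiv.apply_symm_apply]
        rw [this]; exact hk
    · rintro ⟨x, rfl⟩; exact hPl x
  have hthr' : ∀ i ∈ R, ∀ i' ∉ R, wt i < wt i' := by
    intro i hi i' hi'
    obtain ⟨x, rfl⟩ := (hR i).mp hi
    rcases hsi : er.symm i' with x' | y
    · exact absurd ((hR i').mpr ⟨x', by rw [← hsi, Equiv.apply_symm_apply]⟩) hi'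
    · have : i' = er (Sum.inr y) := by rw [← hsi, Equiv.apply_symm_apply]
      rw [this]; exact hthr x y
  have hA' : (Matrix.of fun x x' : Fin n => N0 (er (Sum.inl x)) (ec (Sum.inl x'))).det ≠ 0 := by
    have hmat : (Matrix.of fun x x' : Fin n => N0 (er (Sum.inl x)) (ec (Sum.inl x'))) =
        Matrix.of fun x x' : Fin n => ∏ a ∈ u (er (Sum.inl x)),
          (tx (e (ec (Sum.inl x'))).1 none a +
            ∑ q ∈ (e (ec (Sum.inl x'))).2, tx (e (ec (Sum.inl x'))).1 (some q) a) := by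
      refine Matrix.ext fun x x' => ?_
      simp only [Matrix.of_apply, hN0, hT0, hPl, if_true]
    rw [hmat]; exact hA
  have hB' : (Matrix.of fun y y' : Fin n' => N0 (er (Sum.inr y)) (ec (Sum.inr y'))).det ≠ 0 := by
    have hmat : (Matrix.of fun y y' : Fin n' => N0 (er (Sum.inr y)) (ec (Sum.inr y'))) =
        Matrix.of fun y y' : Fin n' => ∏ a ∈ u (er (Sum.inr y)),
          (tx' (e (ec (Sum.inr y'))).1 none a +
            ∑ q ∈ (e (ec (Sum.inr y'))).2, tx' (e (ec (Sum.inr y'))).1 (some q) a) := by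
      refine Matrix.ext fun y y' => ?_
      simp only [Matrix.of_apply, hN0, hT0, hPr, if_false]
    rw [hmat]; exact hB
  obtain ⟨c, hc⟩ := exists_rowScale_det_ne_zero N0 P R wt er ec hR hP hthr' hA' hB'
  refine ⟨Tc c, ?_⟩
  have hmat : (Matrix.of fun i k : Fin r => ∏ a ∈ u i,
      (Tc c (e k).1 none a + ∑ q ∈ (e k).2, Tc c (e k).1 (some q) a)) =
      Matrix.of fun i k : Fin r => if k ∈ P then c ^ wt i * N0 i k else N0 i k := by
    refine Matrix.ext fun i k => ?_
    by_cases hk : (e k).1 = p₀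
    · have hkP : k ∈ P := by rw [hPdef, Finset.mem_filter]; exact ⟨Finset.mem_univ _, hk⟩
      simp only [Matrix.of_apply, hN0, hTc, hT0, hk, if_true, hkP, hwt]
      exact prod_scaled_cubePoint (tx p₀) (e k).2 w c (u i)
    · have hkP : k ∉ P := by rw [hPdef, Finset.mem_filter]; exact fun hh => hk hh.2
      simp only [Matrix.of_apply, hN0, hTc, hT0, hk, if_false, hkP]
  rw [hmat]
  exact hc

end

end Summit.ValiantsHypothesis.ValiantsHypothesis.Theorems.BarrierLever.SimplexJoin
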